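import Mathlib
import HarnessLib

/-!
# Preliminaries for the SYMMETRIC KERNEL RATIO LEMMA: scalar exponential inequalities, integrability on the support, the first-order expansion of an exponential moment, and the
# monotone-covariance bound for an exponential tilt
# (route `FlatTubeReduction`, crux K1 `NearFlatRatioLaw` stmt-QuantumFields-24720; seat `ym-line-ftr-p1` g15; rate twin «ratepack-v3 / frozen fibres»; R2b1 RECORD rung — no summit
# statement is proved here)

WHY (memo `Cruxes/NearFlatRatioLaw/Lines/ratepack-v3-frozen-g12.md` §5.1, §8.4; PICKED.md g15).  The sequel `…SymmetricKernelRatio` proves `|F₁₂F₂₁ − F₁₁F₂₂| ≤ (ξ + 120η²)F₁₁F₂₂` for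
exponential integrals `F_{ij} = ∫qe^{E_{ij}}` — the device that makes the K-near step of `stub_coreRateOfEM` second order without calculus.  This file holds its elementary inputs:
* `exp_sub_one_sub_le_sq` (`0 ≤ e^a − 1 − a ≤ η²` for `|a| ≤ η ≤ 1`), `mul_exp_sub_exp_le` (`0 ≤ (e^a − e^b)(a − b) ≤ e^c(a − b)²` for `a,b ≤ c`);
* `integrable_mul_of_abs_le_on_support`; ★ `exp_moment_first_order` (`0 ≤ ∫qe^{E'} − ∫qe^{E} − ∫qe^{E}(E'−E) ≤ η²∫qe^{E}`);
* ★★ `exp_tilt_covariance` — for `ρ ≥ 0` and `|Z| ≤ c` on `{ρ ≠ 0}`: `0 ≤ (∫ρ)(∫ρe^{Z}Z) − (∫ρe^{Z})(∫ρZ) ≤ c²e^{c}(∫ρ)²` (the mean of `Z` moves up under the tilt `e^{Z}`, by at most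
  `e^{c}·Var`).
HONEST FRAMING: elementary real analysis; femto rung R2b1 (RECORD label); not infinite volume, not a gap, not Clay.  No defs, no named facts, no `sorry`.
-/

set_option autoImplicit false

noncomputable section

open MeasureTheory Real

namespace Summit.QuantumFields.YangMills.Theorems.FemtoTransferGap.RateTube

/-! ## §1 Scalar inequalities -/

/-- `0 ≤ e^a − 1 − a ≤ η²` for `|a| ≤ η ≤ 1`. [folklore] -/
theorem exp_sub_one_sub_le_sq {a η : ℝ} (ha : |a| ≤ η) (hη : η ≤ 1) : 0 ≤ Real.exp a - 1 - a ∧ Real.exp a - 1 - a ≤ η ^ 2 := by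
  refine ⟨by linarith [Real.add_one_le_exp a], ?_⟩
  have h := Real.abs_exp_sub_one_sub_id_le (ha.trans hη)
  have h2 : a ^ 2 ≤ η ^ 2 := by
    have := abs_nonneg a
    calc a ^ 2 = |a| ^ 2 := (sq_abs a).symm
      _ ≤ η ^ 2 := pow_le_pow_left₀ this ha 2
  linarith [(abs_le.mp (show |Real.exp a - 1 - a| ≤ a ^ 2 from h)).2]

/-- Monotone covariance integrand: `0 ≤ (e^a − e^b)(a − b) ≤ e^{c}(a − b)²` for `a, b ≤ c`. [folklore] -/
theorem mul_exp_sub_exp_le {a b c : ℝ} (ha : a ≤ c) (hb : b ≤ c) :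
    0 ≤ (Real.exp a - Real.exp b) * (a - b) ∧ (Real.exp a - Real.exp b) * (a - b) ≤ Real.exp c * (a - b) ^ 2 := by
  have h1 : Real.exp b * (a - b) ≤ Real.exp a - Real.exp b := by
    have := Real.add_one_le_exp (a - b)
    have e : Real.exp a = Real.exp b * Real.exp (a - b) := by rw [← Real.exp_add]; ring_nf
    nlinarith [Real.exp_pos b]
  have h2 : Real.exp a * (b - a) ≤ Real.exp b - Real.exp a := by
    have := Real.add_one_le_exp (b - a)
    have e : Real.exp b = Real.exp a * Real.exp (b - a) := by rw [← Real.exp_add]; ring_nf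
    nlinarith [Real.exp_pos a]
  have hea : Real.exp a ≤ Real.exp c := Real.exp_le_exp.mpr ha
  have heb : Real.exp b ≤ Real.exp c := Real.exp_le_exp.mpr hb
  rcases le_total b a with hab | hab
  · have hd : 0 ≤ a - b := by linarith
    have hE : 0 ≤ Real.exp a - Real.exp b := by linarith [Real.exp_le_exp.mpr hab]
    refine ⟨mul_nonneg hE hd, ?_⟩
    -- `e^a − e^b ≤ e^a (a − b) ≤ e^c (a − b)`
    have h3 : Real.exp a - Real.exp b ≤ Real.exp a * (a - b) := by linarith
    calc (Real.exp a - Real.exp b) * (a - b) ≤ Real.exp a * (a - b) * (a - b) := mul_le_mul_of_nonneg_right h3 hd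
      _ ≤ Real.exp c * (a - b) * (a - b) := mul_le_mul_of_nonneg_right (mul_le_mul_of_nonneg_right hea hd) hd
      _ = Real.exp c * (a - b) ^ 2 := by ring
  · have hd : a - b ≤ 0 := by linarith
    have hE : Real.exp a - Real.exp b ≤ 0 := by linarith [Real.exp_le_exp.mpr hab]
    refine ⟨mul_nonneg_of_nonpos_of_nonpos hE hd, ?_⟩
    have h3 : Real.exp b - Real.exp a ≤ Real.exp b * (b - a) := by linarith
    have hd' : 0 ≤ b - a := by linarith
    calc (Real.exp a - Real.exp b) * (a - b) = (Real.exp b - Real.exp a) * (b - a) := by ring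
      _ ≤ Real.exp b * (b - a) * (b - a) := mul_le_mul_of_nonneg_right h3 hd'
      _ ≤ Real.exp c * (b - a) * (b - a) := mul_le_mul_of_nonneg_right (mul_le_mul_of_nonneg_right heb hd') hd'
      _ = Real.exp c * (a - b) ^ 2 := by ring

/-! ## §2 Integrability bookkeeping -/

variable {X : Type*} [MeasurableSpace X] {μ : Measure X}

/-- If `ρ` is integrable and `|φ| ≤ C` wherever `ρ ≠ 0` (`φ` measurable), then `ρ·φ` is integrable. [folklore] -/
theorem integrable_mul_of_abs_le_on_support {ρ φ : X → ℝ} (hρ : Integrable ρ μ) (hφ : Measurable φ) {C : ℝ} (hC : ∀ x, ρ x ≠ 0 → |φ x| ≤ C) :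
    Integrable (fun x => ρ x * φ x) μ := by
  have hC0 : ∀ x, |ρ x * φ x| ≤ |C| * |ρ x| := fun x => by
    by_cases h : ρ x = 0
    · rw [h]; simp
    · rw [abs_mul, mul_comm]
      exact mul_le_mul_of_nonneg_right ((hC x h).trans (le_abs_self C)) (abs_nonneg _)
  refine Integrable.mono' (hρ.abs.const_mul |C|) (hρ.aestronglyMeasurable.mul hφ.aestronglyMeasurable) (Filter.Eventually.of_forall fun x => ?_)
  rw [Real.norm_eq_abs]
  exact hC0 x

/-- First-order expansion of an exponential moment: for `ρ = q·e^{E} ≥ 0` and `|E' − E| ≤ η ≤ 1` on `{q ≠ 0}`,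
`0 ≤ ∫qe^{E'} − ∫qe^{E} − ∫qe^{E}(E' − E) ≤ η²∫qe^{E}`. [folklore] -/
theorem exp_moment_first_order {q E E' A : X → ℝ} (hq0 : ∀ x, 0 ≤ q x) (hA : A = fun x => E' x - E x)
    (hI : Integrable (fun x => q x * Real.exp (E x)) μ) (hI' : Integrable (fun x => q x * Real.exp (E' x)) μ)
    (hIA : Integrable (fun x => q x * Real.exp (E x) * A x) μ) {η : ℝ} (hη1 : η ≤ 1) (hb : ∀ x, q x ≠ 0 → |A x| ≤ η) :
    0 ≤ (∫ x, q x * Real.exp (E' x) ∂μ) - (∫ x, q x * Real.exp (E x) ∂μ) - ∫ x, q x * Real.exp (E x) * A x ∂μ ∧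
      (∫ x, q x * Real.exp (E' x) ∂μ) - (∫ x, q x * Real.exp (E x) ∂μ) - ∫ x, q x * Real.exp (E x) * A x ∂μ ≤ η ^ 2 * ∫ x, q x * Real.exp (E x) ∂μ := by
  have e1 : (fun x => q x * Real.exp (E x) * (Real.exp (A x) - 1 - A x)) = fun x => (q x * Real.exp (E' x) - q x * Real.exp (E x)) - q x * Real.exp (E x) * A x := by
    funext x; simp only [hA]
    have : Real.exp (E' x) = Real.exp (E x) * Real.exp (E' x - E x) := by rw [← Real.exp_add]; ring_nf
    rw [this]; ring
  have hint12 : Integrable (fun x => q x * Real.exp (E' x) - q x * Real.exp (E x)) μ := hI'.sub hI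
  have hint : Integrable (fun x => q x * Real.exp (E x) * (Real.exp (A x) - 1 - A x)) μ := by rw [e1]; exact hint12.sub hIA
  have e : ∫ x, q x * Real.exp (E x) * (Real.exp (A x) - 1 - A x) ∂μ =
      (∫ x, q x * Real.exp (E' x) ∂μ) - (∫ x, q x * Real.exp (E x) ∂μ) - ∫ x, q x * Real.exp (E x) * A x ∂μ := by
    rw [e1, integral_sub hint12 hIA, integral_sub hI' hI]
  have hpt : ∀ x, 0 ≤ q x * Real.exp (E x) * (Real.exp (A x) - 1 - A x) ∧ q x * Real.exp (E x) * (Real.exp (A x) - 1 - A x) ≤ η ^ 2 * (q x * Real.exp (E x)) :=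
    fun x => by
    by_cases hx : q x = 0
    · simp [hx]
    · have h := exp_sub_one_sub_le_sq (hb x hx) hη1
      have h0 : 0 ≤ q x * Real.exp (E x) := mul_nonneg (hq0 x) (Real.exp_pos _).le
      exact ⟨mul_nonneg h0 h.1, by rw [mul_comm]; exact mul_le_mul_of_nonneg_right h.2 h0⟩
  rw [← e]
  refine ⟨integral_nonneg fun x => (hpt x).1, (integral_mono hint (hI.const_mul _) fun x => (hpt x).2).trans ?_⟩
  rw [integral_const_mul]

/-- ★★ **Monotone covariance under an exponential tilt**: `ρ ≥ 0` integrable, `Z` measurable with `|Z| ≤ c` on `{ρ ≠ 0}`, `ρe^{Z}` integrable.  Then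
`0 ≤ (∫ρ)(∫ρe^{Z}Z) − (∫ρe^{Z})(∫ρZ) ≤ c²e^{c}(∫ρ)²`. [folklore] -/
theorem exp_tilt_covariance {ρ Z : X → ℝ} (hρ0 : ∀ x, 0 ≤ ρ x) (hρ : Integrable ρ μ) (hmZ : Measurable Z) (hIe : Integrable (fun x => ρ x * Real.exp (Z x)) μ)
    {c : ℝ} (hb : ∀ x, ρ x ≠ 0 → |Z x| ≤ c) :
    0 ≤ (∫ x, ρ x ∂μ) * (∫ x, ρ x * Real.exp (Z x) * Z x ∂μ) - (∫ x, ρ x * Real.exp (Z x) ∂μ) * (∫ x, ρ x * Z x ∂μ) ∧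
      (∫ x, ρ x ∂μ) * (∫ x, ρ x * Real.exp (Z x) * Z x ∂μ) - (∫ x, ρ x * Real.exp (Z x) ∂μ) * (∫ x, ρ x * Z x ∂μ) ≤ c ^ 2 * Real.exp c * (∫ x, ρ x ∂μ) ^ 2 := by
  have hc0 : ∀ x, ρ x ≠ 0 → 0 ≤ c := fun x hx => (abs_nonneg _).trans (hb x hx)
  have hIZ : Integrable (fun x => ρ x * Z x) μ := integrable_mul_of_abs_le_on_support hρ hmZ hb
  have hIeZ : Integrable (fun x => ρ x * Real.exp (Z x) * Z x) μ :=
    integrable_mul_of_abs_le_on_support hIe hmZ fun x hx => hb x (left_ne_zero_of_mul hx)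
  obtain ⟨F, hF⟩ : ∃ F : ℝ, F = ∫ x, ρ x ∂μ := ⟨_, rfl⟩
  obtain ⟨G, hG⟩ : ∃ F : ℝ, F = ∫ x, ρ x * Real.exp (Z x) ∂μ := ⟨_, rfl⟩
  obtain ⟨I, hI⟩ : ∃ F : ℝ, F = ∫ x, ρ x * Z x ∂μ := ⟨_, rfl⟩
  obtain ⟨J, hJ⟩ : ∃ F : ℝ, F = ∫ x, ρ x * Real.exp (Z x) * Z x ∂μ := ⟨_, rfl⟩
  rw [← hF, ← hG, ← hI, ← hJ]
  have hF0 : 0 ≤ F := by rw [hF]; exact integral_nonneg hρ0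
  have hIb : |I| ≤ c * F := by
    rw [hI, hF]
    have hpt : ∀ x, |ρ x * Z x| ≤ c * ρ x := fun x => by
      by_cases hx : ρ x = 0
      · rw [hx]; simp
      · rw [abs_mul, abs_of_nonneg (hρ0 x), mul_comm]; exact mul_le_mul_of_nonneg_right (hb x hx) (hρ0 x)
    calc |∫ x, ρ x * Z x ∂μ| ≤ ∫ x, |ρ x * Z x| ∂μ := abs_integral_le_integral_abs
      _ ≤ ∫ x, c * ρ x ∂μ := integral_mono hIZ.abs (hρ.const_mul c) hpt
      _ = c * ∫ x, ρ x ∂μ := integral_const_mul _ _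
  by_cases hF00 : F = 0
  · -- `ρ = 0` a.e.: everything vanishes
    have hae : ρ =ᵐ[μ] 0 := (integral_eq_zero_iff_of_nonneg (fun x => hρ0 x) hρ).mp (by rw [← hF]; exact hF00)
    have hG0 : G = 0 := by
      rw [hG]; refine (integral_congr_ae (hae.mono fun x hx => ?_)).trans (integral_zero _ _)
      simp [hx]
    rw [hF00, hG0]; simp
  have hFp : 0 < F := lt_of_le_of_ne hF0 (Ne.symm hF00)
  obtain ⟨m, hm⟩ : ∃ m : ℝ, m = I / F := ⟨_, rfl⟩
  have hmF : m * F = I := by rw [hm]; field_simp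
  have hm_b : |m| ≤ c := by rw [hm, abs_div, abs_of_pos hFp, div_le_iff₀ hFp]; exact hIb
  -- `F·J − G·I = F·∫ρ(e^Z − e^m)(Z − m)`
  have e : (fun x => ρ x * ((Real.exp (Z x) - Real.exp m) * (Z x - m))) =
      fun x => ρ x * Real.exp (Z x) * Z x - m * (ρ x * Real.exp (Z x)) - Real.exp m * (ρ x * Z x) + (Real.exp m * m) * ρ x := by
    funext x; ring
  have hA1 : Integrable (fun x => ρ x * Real.exp (Z x) * Z x - m * (ρ x * Real.exp (Z x))) μ := hIeZ.sub (hIe.const_mul m)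
  have hA2 : Integrable (fun x => ρ x * Real.exp (Z x) * Z x - m * (ρ x * Real.exp (Z x)) - Real.exp m * (ρ x * Z x)) μ := hA1.sub (hIZ.const_mul _)
  have hcov_eq : F * J - G * I = F * ∫ x, ρ x * ((Real.exp (Z x) - Real.exp m) * (Z x - m)) ∂μ := by
    rw [e, integral_add hA2 (hρ.const_mul _), integral_sub hA1 (hIZ.const_mul _), integral_sub hIeZ (hIe.const_mul m),
      integral_const_mul, integral_const_mul, integral_const_mul, ← hJ, ← hG, ← hI, ← hF, ← hmF]
    ring
  -- pointwise: `0 ≤ ρ(e^Z − e^m)(Z − m) ≤ e^{c}ρ(Z − m)²`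
  have hpt : ∀ x, 0 ≤ ρ x * ((Real.exp (Z x) - Real.exp m) * (Z x - m)) ∧
      ρ x * ((Real.exp (Z x) - Real.exp m) * (Z x - m)) ≤ Real.exp c * (ρ x * (Z x - m) ^ 2) := fun x => by
    by_cases hx : ρ x = 0
    · rw [hx]; simp
    · have h := mul_exp_sub_exp_le (abs_le.mp (hb x hx)).2 (abs_le.mp hm_b).2
      refine ⟨mul_nonneg (hρ0 x) h.1, ?_⟩
      calc ρ x * ((Real.exp (Z x) - Real.exp m) * (Z x - m)) ≤ ρ x * (Real.exp c * (Z x - m) ^ 2) := mul_le_mul_of_nonneg_left h.2 (hρ0 x)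
        _ = Real.exp c * (ρ x * (Z x - m) ^ 2) := by ring
  have hIsq : Integrable (fun x => ρ x * (Z x - m) ^ 2) μ :=
    integrable_mul_of_abs_le_on_support hρ ((hmZ.sub measurable_const).pow_const 2) (C := (2 * c) ^ 2) fun x hx => by
      rw [abs_pow]; refine pow_le_pow_left₀ (abs_nonneg _) ?_ 2
      exact (abs_sub _ _).trans (by linarith [hb x hx, hm_b])
  have hIcov : Integrable (fun x => ρ x * ((Real.exp (Z x) - Real.exp m) * (Z x - m))) μ := by rw [e]; exact hA2.add (hρ.const_mul _)
  -- `∫ρ(Z − m)² = ∫ρZ² − m²F ≤ c²F`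
  have hvar : ∫ x, ρ x * (Z x - m) ^ 2 ∂μ ≤ c ^ 2 * F := by
    have hIZZ : Integrable (fun x => ρ x * Z x ^ 2) μ :=
      integrable_mul_of_abs_le_on_support hρ (hmZ.pow_const 2) (C := c ^ 2) fun x hx => by
        rw [abs_pow]; exact pow_le_pow_left₀ (abs_nonneg _) (hb x hx) 2
    have e2 : (fun x => ρ x * (Z x - m) ^ 2) = fun x => ρ x * Z x ^ 2 - (2 * m) * (ρ x * Z x) + m ^ 2 * ρ x := by funext x; ring
    have hB1 : Integrable (fun x => ρ x * Z x ^ 2 - (2 * m) * (ρ x * Z x)) μ := hIZZ.sub (hIZ.const_mul _)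
    have h1 : ∫ x, ρ x * Z x ^ 2 ∂μ ≤ c ^ 2 * F := by
      have hpt2 : ∀ x, ρ x * Z x ^ 2 ≤ c ^ 2 * ρ x := fun x => by
        by_cases hx : ρ x = 0
        · rw [hx]; simp
        · rw [mul_comm]; refine mul_le_mul_of_nonneg_right ?_ (hρ0 x)
          have := pow_le_pow_left₀ (abs_nonneg _) (hb x hx) 2
          rwa [sq_abs] at this
      rw [hF, ← integral_const_mul]; exact integral_mono hIZZ (hρ.const_mul _) hpt2
    have hmm : 0 ≤ m ^ 2 * F := mul_nonneg (sq_nonneg m) hF0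
    rw [e2, integral_add hB1 (hρ.const_mul _), integral_sub hIZZ (hIZ.const_mul _), integral_const_mul, integral_const_mul, ← hI, ← hF, ← hmF]
    have : -(2 * m * (m * F)) + m ^ 2 * F = -(m ^ 2 * F) := by ring
    linarith [h1, hmm, this]
  rw [hcov_eq]
  refine ⟨mul_nonneg hF0 (integral_nonneg fun x => (hpt x).1), ?_⟩
  have hstep : ∫ x, ρ x * ((Real.exp (Z x) - Real.exp m) * (Z x - m)) ∂μ ≤ Real.exp c * (c ^ 2 * F) := by
    refine (integral_mono hIcov (hIsq.const_mul (Real.exp c)) fun x => (hpt x).2).trans ?_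
    rw [integral_const_mul]; exact mul_le_mul_of_nonneg_left hvar (Real.exp_pos _).le
  calc F * ∫ x, ρ x * ((Real.exp (Z x) - Real.exp m) * (Z x - m)) ∂μ ≤ F * (Real.exp c * (c ^ 2 * F)) := mul_le_mul_of_nonneg_left hstep hF0
    _ = c ^ 2 * Real.exp c * F ^ 2 := by ring

end Summit.QuantumFields.YangMills.Theorems.FemtoTransferGap.RateTube

end
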